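/-
Copyright (c) 2026 the pub-hodgecm-mathlib formalisation cell (harness21).  Prover seat hodgecm-mathlib-B-p14 (g30), (F11) «ramified torus `(EL)¹ × E¹`», sub-brick
(F1′) «ANISOTROPIC DOUBLE COSETS» (architect A-p06 (g26) 04:34Z «go»; frame of B-p17 (g24)'s ★ (F1) `UnitaryThreeDoubleCosetsHK`), 2026-09-01.
-/
import Literature.NumberTheory.Automorphic.UnitaryAntidiagAnisotropicTransitivity   -- ★ p841059 (this seat): `K₀` transitive on primitive vectors of given non-unit norm
import Literature.NumberTheory.Automorphic.UnitaryThreeDoubleCosetsHK               -- ★ p840820 (B-p17): the frame, `mem_unitaryInt_iff_forall_v_apply_le_one`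
import HarnessLib

/-!
# Flicker's SECOND double-coset decomposition `G = ⊔_{m ≥ 0} H″ · d_m · K` of the quasi-split `p`-adic `U(3)` — `H″` the stabiliser of an ANISOTROPIC vector
# (Flicker 1998, Prop. 4 second half, pp. 80–82) — existence (A′) and disjointness (B′)

Topic `NumberTheory/Automorphic`; namespace `Literature.NumberTheory.Automorphic.UnitaryGroup`.  THEOREMS ONLY (no `def`, no instance, no notation, no named fact,
no `sorry`).  Cell `pub/hodgecm-mathlib`, crux H413 = `stmt-HodgeConjecture-24833`, road «N7-ns COUNT FROM FLICKER» (MAP v3, architect A-p06 (g26)), line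
«N7nsCount», brick (F11) «ramified torus `(EL)¹ × E¹`» — sub-brick **(F1′)**: the decomposition through which the orbital integral `Φ′(t″)` of `1_K` at the
`κ = −1` class of a type-(2) element unfolds (Prop. 5 last claim, Props. 16–17).  FRAME = ★ (F1) (B-p17 (g24)): `K` a field with `Valued K ℤᵐ⁰` and a ★
`LocalConjDatum σ ϖ`, `U = U(σ, Φ₃)(K)` (`hJ : J = (StdForm.antidiagonal 3).over K`), `K₀ = unitaryInt σ J`.

THE OBJECTS (hypothesis-parametrised, as in ★ (F1)).  `w₀ := e₀ − 2ϖ·e₂ = ![1, 0, −2ϖ]` — an INTEGRAL PRIMITIVE ANISOTROPIC vector, `B₀ w₀ w₀ = −4ϖ`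
(non-unit norm; Flicker's `ν₀ = (−1, 0, 1∕2π)` has `⟨ν₀,ν₀⟩ = −π⁻¹`, the same square class); `H″ := Stab_U(w₀)` (Flicker's `gH′g⁻¹ = Z_G(…) = Stab(ν₀)`, the
unitary group of the anisotropic plane `w₀^⊥` times `E¹`); `d_m := diag(ϖ^m, 1, ϖ^{−m}) ∈ U` (`exists_coe_eq_flickerDiag`).
* (A′) **`exists_stabilizer_mul_flickerDiag_mul_unitaryInt`**: every `x ∈ U` is `h · d_m · k` with `m ≥ 0`, `h w₀ = w₀`, `k ∈ K₀`.  PROOF: `w := x⁻¹ w₀` has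
  `B₀ w w = −4ϖ`; normalise by its largest coordinate `w_j` (★ `exists_inv_smul_mem_stdLattice`): `v := w_j⁻¹ w` is primitive integral with norm
  `a = −4ϖ∕(w_j σw_j)`, `|a| ≤ 1` forces `|w_j| = q^{m} ≥ 1`, so `|a| < 1`; ★ (F1′-W) `exists_mem_unitaryInt_mulVec_normalForm_eq` gives `k₁ ∈ K₀` with
  `k₁(e₀ + (a∕2)e₂) = v`; the torus element `t = diag(w_j, 1, (σw_j)⁻¹) ∈ U` has `t w₀ = w_j·(e₀ + (a∕2)e₂)`; hence `(x k₁ t) w₀ = w₀` and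
  `x = h · t⁻¹ · k₁⁻¹` with `t⁻¹ = d_m · diag(ε, 1, (σε)⁻¹)`, `ε = ϖ^{−m} w_j⁻¹` a unit (so the second factor lies in `K₀`).
* (B′) **`eq_of_stabilizer_mul_flickerDiag_mul_unitaryInt_eq`**: `h d_m k = h′ d_n k′` (`h, h′` in the LINE stabiliser `h w₀ ∈ K·w₀`, `k, k′ ∈ K₀`) ⇒ `m = n` —
  the invariant is the SUP-NORM of `g⁻¹ w₀`: `= q^{m}` on `H″ d_m K₀` (`|κ| = 1` for `h w₀ = κw₀` since `B₀ w₀ w₀ ≠ 0`; `K₀` preserves sup-norms).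
NOT HERE: the stabiliser `H′_m = H″ ∩ d_m K₀ d_m⁻¹` by congruences (Flicker p. 82; file 2), the unfolding of `Φ′(t″)` ((F2′) over ★ B-p12 (F2a)), Prop. 16's count.
HONEST LABEL: HC_CM is proved only modulo the printed citations until rung 0 closes; structure theory feeding ONE value stub of #103-ns, pays nothing by itself.

## References
* [Flicker1998UnitaryFL] Y. Z. Flicker, *Elementary proof of the fundamental lemma for a unitary group*, Canad. J. Math. 50 (1998), §2 p. 78 (`T_{H′} ⊂ H′ ⊂ G′`),
  §3 Prop. 4 pp. 80–82 («Also `G = ⊔_{m ≥ 0} H″ d_m K`», the sphere `S`), Prop. 5 p. 82 (last claim).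
* [Rogawski1990] J. D. Rogawski, *Automorphic Representations of Unitary Groups in Three Variables* (1990), §1.9–§1.10 pp. 8–9.
* [Omeara1963] O. T. O'Meara, *Introduction to Quadratic Forms* (1963), §82F.
-/

set_option autoImplicit false

noncomputable section

open scoped MatrixGroups WithZero
open Matrix

namespace Literature.NumberTheory.Automorphic

namespace UnitaryGroup

open Literature.NumberTheory.Automorphic.HermitianLattice

variable {K : Type*} [Field K] [Valued K ℤᵐ⁰] {ϖ : K}
  (σ : K →+* K) {J : Matrix (Fin 3) (Fin 3) K} (hJ : J = (StdForm.antidiagonal 3).over K)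

/-- `rev` on `Fin 3`. [folklore] -/ private theorem rev0₃ : Fin.rev (0 : Fin 3) = 2 := rfl
/-- `rev` on `Fin 3`. [folklore] -/ private theorem rev1₃ : Fin.rev (1 : Fin 3) = 1 := rfl
/-- `rev` on `Fin 3`. [folklore] -/ private theorem rev2₃ : Fin.rev (2 : Fin 3) = 0 := rfl

/-! ## §1 The torus elements `diag(α, 1, (σα)⁻¹)` and `d_m`, the vector `w₀` -/

omit [Valued K ℤᵐ⁰] in
include hJ in
/-- Constructor (as in ★ (F1)): a `3 × 3` matrix with non-zero determinant satisfying the nine unitarity relations is an element of `U(σ, Φ₃)`. [folklore] -/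
private theorem exists_coe_eq_of_sum₃ (M : Matrix (Fin 3) (Fin 3) K) (hdet : M.det ≠ 0)
    (hsum : ∀ a b : Fin 3, ∑ i, σ (M i a) * M (Fin.rev i) b = if b = Fin.rev a then 1 else 0) :
    ∃ g : ↥(unitaryGroupOfForm σ J), ((g : GL (Fin 3) K) : Matrix (Fin 3) (Fin 3) K) = M := by
  have hmem : Matrix.GeneralLinearGroup.mkOfDetNeZero M hdet ∈ unitaryGroupOfForm σ J := by
    rw [hJ, mem_unitaryGroupOfForm_antidiagonal_iff_sum']
    simpa [Matrix.GeneralLinearGroup.val_mkOfDetNeZero] using hsum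
  exact ⟨⟨_, hmem⟩, Matrix.GeneralLinearGroup.val_mkOfDetNeZero _ _⟩

omit [Valued K ℤᵐ⁰] in
include hJ in
/-- **The torus element `diag(α, 1, (σα)⁻¹) ∈ U(σ, Φ₃)`** (`α ≠ 0`, `σ² = 1`). [cite: Rogawski1990, §1.10 p. 9] [cite: Flicker1998UnitaryFL, Prop. 4 p. 80 (`d_m`)] -/
theorem exists_coe_eq_torusDiag (hσ : ∀ a, σ (σ a) = a) {α : K} (hα : α ≠ 0) :
    ∃ t : ↥(unitaryGroupOfForm σ J), ((t : GL (Fin 3) K) : Matrix (Fin 3) (Fin 3) K) = !![α, 0, 0; 0, 1, 0; 0, 0, (σ α)⁻¹] := by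
  have hσα : σ α ≠ 0 := (map_ne_zero σ).2 hα
  refine exists_coe_eq_of_sum₃ σ hJ _ ?_ ?_
  · rw [Matrix.det_fin_three]; simp [hα, hσα]
  · intro a b
    fin_cases a <;> fin_cases b <;> simp [Fin.sum_univ_three, rev1₃, rev2₃, map_inv₀, hσ, hσα, hα]

include hJ in
/-- **Flicker's `d_m = diag(ϖ^m, 1, ϖ^{−m}) ∈ U(σ, Φ₃)`.** [cite: Flicker1998UnitaryFL, Prop. 4 p. 80] -/
theorem exists_coe_eq_flickerDiag (hd : LocalConjDatum σ ϖ) (m : ℕ) :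
    ∃ d : ↥(unitaryGroupOfForm σ J), ((d : GL (Fin 3) K) : Matrix (Fin 3) (Fin 3) K) = !![ϖ ^ m, 0, 0; 0, 1, 0; 0, 0, (ϖ ^ m)⁻¹] := by
  have hσt : σ (ϖ ^ m) = ϖ ^ m := by rw [map_pow, hd.σϖ]
  obtain ⟨d, hd'⟩ := exists_coe_eq_torusDiag σ hJ hd.σσ (pow_ne_zero m hd.ϖ_ne_zero)
  exact ⟨d, by rw [hd', hσt]⟩

omit [Valued K ℤᵐ⁰] in
include hJ in
/-- A unitary matrix preserves `B₀`: `B₀ (g u) (g v) = B₀ u v`. [cite: Rogawski1990, §1.9 p. 8] -/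
theorem B₀_mulVec_mulVec_of_mem (g : ↥(unitaryGroupOfForm σ J)) (u v : Fin 3 → K) :
    B₀ σ 3 (((g : GL (Fin 3) K) : Matrix (Fin 3) (Fin 3) K) *ᵥ u) (((g : GL (Fin 3) K) : Matrix (Fin 3) (Fin 3) K) *ᵥ v) = B₀ σ 3 u v := by
  have hg : ((g : GL (Fin 3) K)) ∈ unitaryGroupOfForm σ ((StdForm.antidiagonal 3).over K) := by rw [← hJ]; exact g.2
  exact (mem_unitaryGroupOfForm_antidiagonal_iff _).1 hg u v

omit [Valued K ℤᵐ⁰] in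
/-- `w₀ = e₀ − 2ϖ·e₂` as a combination of basis vectors. [cite: Flicker1998UnitaryFL, Prop. 4 p. 81] -/
theorem anisoVec_eq_single_add (h2 : (2 : K) ≠ 0) (ϖ : K) :
    (![1, 0, -(2 * ϖ)] : Fin 3 → K) = Pi.single 0 1 + (-(4 * ϖ) / 2) • Pi.single (Fin.rev 0) 1 := by
  rw [rev0₃]
  ext i
  fin_cases i
  · simp
  · simp
  · simp
    field_simp
    ring

omit [Valued K ℤᵐ⁰] in
/-- **`B₀ w₀ w₀ = −4ϖ`** (`σ ϖ = ϖ`): `w₀` is ANISOTROPIC of non-unit norm. [cite: Flicker1998UnitaryFL, Prop. 4 p. 81 (`⟨ν₀, ν₀⟩ = −π⁻¹`)] -/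
theorem B₀_anisoVec (hσϖ : σ ϖ = ϖ) : B₀ σ 3 (![1, 0, -(2 * ϖ)] : Fin 3 → K) ![1, 0, -(2 * ϖ)] = -(4 * ϖ) := by
  simp [B₀_apply, Fin.sum_univ_three, rev1₃, rev2₃, map_neg, map_mul, hσϖ, map_ofNat]
  ring

omit [Valued K ℤᵐ⁰] in
/-- The torus element on `w₀`: `diag(α, 1, (σα)⁻¹) · w₀ = α · (e₀ + (a∕2) e₂)` with `a = −4ϖ ∕ (α σα)` (`α ≠ 0`). [cite: Flicker1998UnitaryFL, Prop. 4 p. 82] -/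
theorem torusDiag_mulVec_anisoVec (h2 : (2 : K) ≠ 0) {α : K} (hα : α ≠ 0) (hσα : σ α ≠ 0) (ϖ : K) :
    (!![α, 0, 0; 0, 1, 0; 0, 0, (σ α)⁻¹] : Matrix (Fin 3) (Fin 3) K) *ᵥ ![1, 0, -(2 * ϖ)] =
      α • (Pi.single 0 1 + ((-(4 * ϖ) * ((σ α)⁻¹ * α⁻¹)) / 2) • Pi.single (Fin.rev 0) 1) := by
  rw [rev0₃]
  ext i
  fin_cases i
  · simp [Matrix.mulVec, dotProduct, Fin.sum_univ_three]
  · simp [Matrix.mulVec, dotProduct, Fin.sum_univ_three]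
  · simp [Matrix.mulVec, dotProduct, Fin.sum_univ_three]
    field_simp
    ring

/-! ## §2 (A′) Existence: `U = ⋃_{m ≥ 0} Stab(w₀) · d_m · K₀` -/

/-- An element of `ℤᵐ⁰` which is `≥ 1` and non-zero is `exp m` for a natural number `m`. [folklore] -/
private theorem exists_nat_eq_exp_of_one_le {x : ℤᵐ⁰} (hx0 : x ≠ 0) (hx : 1 ≤ x) : ∃ m : ℕ, x = WithZero.exp (m : ℤ) := by
  have hlog : 0 ≤ WithZero.log x := by
    rw [← WithZero.exp_le_exp, WithZero.exp_log hx0, WithZero.exp_zero]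
    exact hx
  refine ⟨(WithZero.log x).toNat, ?_⟩
  rw [Int.toNat_of_nonneg hlog, WithZero.exp_log hx0]

include hJ in
/-- **(A′) FLICKER'S SECOND DECOMPOSITION — existence.**  For every `x ∈ U(σ, Φ₃)(K)` there are `m ≥ 0`, `h ∈ U` FIXING `w₀ = ![1, 0, −2ϖ]`, the torus element
`d_m = diag(ϖ^m, 1, ϖ^{−m})` and `k ∈ K₀ = U ∩ GL₃(𝒪)` with `x = h · d_m · k` — «`G = ⊔_{m ≥ 0} H″ d_m K`», `H″ = Stab(w₀)`.
[cite: Flicker1998UnitaryFL, Prop. 4 pp. 80–82] [cite: Omeara1963, §82F] -/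
theorem exists_stabilizer_mul_flickerDiag_mul_unitaryInt (hd : LocalConjDatum σ ϖ) (x : ↥(unitaryGroupOfForm σ J)) :
    ∃ (m : ℕ) (h d k : ↥(unitaryGroupOfForm σ J)),
      ((h : GL (Fin 3) K) : Matrix (Fin 3) (Fin 3) K) *ᵥ ![1, 0, -(2 * ϖ)] = ![1, 0, -(2 * ϖ)] ∧
      ((d : GL (Fin 3) K) : Matrix (Fin 3) (Fin 3) K) = !![ϖ ^ m, 0, 0; 0, 1, 0; 0, 0, (ϖ ^ m)⁻¹] ∧
      k ∈ unitaryInt σ J ∧ x = h * d * k := by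
  have hσ := hd.σσ
  have hvσ := hd.vσ
  have hϖ0 : ϖ ≠ 0 := hd.ϖ_ne_zero
  have h20 : (2 : K) ≠ 0 := fun h0 => by have := hd.v2; rw [h0, map_zero] at this; exact zero_ne_one this
  set w₀ : Fin 3 → K := ![1, 0, -(2 * ϖ)] with hw₀
  -- `w := x⁻¹ w₀`
  set X' : Matrix (Fin 3) (Fin 3) K := (((x⁻¹ : ↥(unitaryGroupOfForm σ J)) : GL (Fin 3) K) : Matrix (Fin 3) (Fin 3) K) with hX'
  set w : Fin 3 → K := X' *ᵥ w₀ with hw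
  have hXX' : (((x : GL (Fin 3) K) : Matrix (Fin 3) (Fin 3) K)) * X' = 1 := by
    rw [hX', Subgroup.coe_inv, ← Units.val_mul, mul_inv_cancel, Units.val_one]
  have hxw : (((x : GL (Fin 3) K) : Matrix (Fin 3) (Fin 3) K)) *ᵥ w = w₀ := by rw [hw, Matrix.mulVec_mulVec, hXX', Matrix.one_mulVec]
  have hw0 : w ≠ 0 := by
    intro h0
    have h1 : w₀ = 0 := by rw [← hxw, h0, Matrix.mulVec_zero]
    have h2 := congrFun h1 0
    simp [hw₀] at h2
  have hBww : B₀ σ 3 w w = -(4 * ϖ) := by rw [hw, B₀_mulVec_mulVec_of_mem σ hJ, B₀_anisoVec σ hd.σϖ]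
  -- normalise by the largest coordinate
  obtain ⟨j, hj0, hvL, hvj⟩ := exists_inv_smul_mem_stdLattice hw0
  set α : K := w j with hαdef
  have hσα0 : σ α ≠ 0 := (map_ne_zero σ).2 hj0
  set v : Fin 3 → K := α⁻¹ • w with hvdef
  set a : K := -(4 * ϖ) * ((σ α)⁻¹ * α⁻¹) with hadef
  have hσa : σ a = a := by
    rw [hadef, map_mul, map_neg, map_mul, map_ofNat, hd.σϖ, map_mul, map_inv₀, map_inv₀, hσ]; ring
  have hvv : B₀ σ 3 v v = a := by
    rw [hvdef]
    simp only [map_smulₛₗ, LinearMap.smul_apply, smul_eq_mul, RingHom.id_apply, hBww, map_inv₀]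
    rw [hadef]; ring
  -- `|a| ≤ 1` forces `|w_j| = q^m ≥ 1`, hence `|a| < 1`
  have ha1 : Valued.v a ≤ 1 := by rw [← hvv]; exact v_B₀_le_one hvσ hvL hvL
  have hva : Valued.v a = WithZero.exp (-1 : ℤ) * ((Valued.v α)⁻¹ * (Valued.v α)⁻¹) := by
    rw [hadef, map_mul, Valuation.map_neg, map_mul, map_mul, map_inv₀, map_inv₀, hvσ,
      show (4 : K) = 2 * 2 by norm_num, map_mul, hd.v2, one_mul, one_mul, hd.vϖ]
  have hvα0 : Valued.v α ≠ 0 := (Valuation.ne_zero_iff _).2 hj0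
  have hα1 : 1 ≤ Valued.v α := by
    by_contra hlt
    rw [not_le, v_lt_one_iff] at hlt
    have h2 : Valued.v a * (Valued.v α * Valued.v α) = WithZero.exp (-1 : ℤ) := by
      rw [hva]; field_simp
    have h3 : Valued.v α * Valued.v α ≤ WithZero.exp (-2 : ℤ) := by
      calc Valued.v α * Valued.v α ≤ WithZero.exp (-1 : ℤ) * WithZero.exp (-1 : ℤ) := mul_le_mul' hlt hlt
        _ = WithZero.exp (-2 : ℤ) := by rw [← WithZero.exp_add]; norm_num
    have h4 : WithZero.exp (-1 : ℤ) ≤ WithZero.exp (-2 : ℤ) := by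
      rw [← h2]
      calc Valued.v a * (Valued.v α * Valued.v α) ≤ 1 * WithZero.exp (-2 : ℤ) := mul_le_mul' ha1 h3
        _ = WithZero.exp (-2 : ℤ) := one_mul _
    rw [WithZero.exp_le_exp] at h4
    omega
  obtain ⟨m, hm⟩ := exists_nat_eq_exp_of_one_le hvα0 hα1
  have halt : Valued.v a < 1 := by
    rw [hva]
    calc WithZero.exp (-1 : ℤ) * ((Valued.v α)⁻¹ * (Valued.v α)⁻¹) ≤ WithZero.exp (-1 : ℤ) * (1 * 1) := by
          refine mul_le_mul' le_rfl (mul_le_mul' ?_ ?_) <;> exact inv_le_one_of_one_le₀ hα1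
      _ < 1 := by rw [mul_one, mul_one, ← WithZero.exp_zero, WithZero.exp_lt_exp]; norm_num
  -- a unit coordinate off the `rev`-fixed index, and the transitivity engine (F1′-W)
  obtain ⟨j', hj', hj'u⟩ := exists_rev_ne_v_eq_one_of_v_B₀_lt_one hvσ hvL ⟨j, by rw [hvj, map_one]⟩ (hvv ▸ halt)
  obtain ⟨k₁, hk₁, hk₁v⟩ := exists_mem_unitaryInt_mulVec_normalForm_eq (N := 3) hσ hvσ hd.v2 hσa ha1 hvL hj' hj'u hvv
    (i₀ := 0) (by rw [rev0₃]; decide)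
  -- the torus element `t = diag(α, 1, (σα)⁻¹)`: `t w₀ = α · n(a)`
  obtain ⟨t, ht⟩ := exists_coe_eq_torusDiag σ hJ hσ hj0
  have htw : ((t : GL (Fin 3) K) : Matrix (Fin 3) (Fin 3) K) *ᵥ w₀ = α • (Pi.single 0 1 + (a / 2) • Pi.single (Fin.rev 0) 1) := by
    rw [ht, hw₀, torusDiag_mulVec_anisoVec σ h20 hj0 hσα0 ϖ]
  have hk₁J : ((k₁ : GL (Fin 3) K)) ∈ unitaryGroupOfForm σ J := by rw [hJ]; exact k₁.2
  set k₁' : ↥(unitaryGroupOfForm σ J) := ⟨(k₁ : GL (Fin 3) K), hk₁J⟩ with hk₁'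
  -- `(x k₁ t) w₀ = w₀`
  have hfix : (((x * k₁' * t : ↥(unitaryGroupOfForm σ J)) : GL (Fin 3) K) : Matrix (Fin 3) (Fin 3) K) *ᵥ w₀ = w₀ := by
    rw [Subgroup.coe_mul, Subgroup.coe_mul, Units.val_mul, Units.val_mul, ← Matrix.mulVec_mulVec, ← Matrix.mulVec_mulVec, htw,
      Matrix.mulVec_smul, show (((k₁' : GL (Fin 3) K) : Matrix (Fin 3) (Fin 3) K)) = ((k₁ : GL (Fin 3) K) : Matrix (Fin 3) (Fin 3) K) from rfl,
      hk₁v, hvdef, smul_smul, mul_inv_cancel₀ hj0, one_smul, hxw]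
  -- `t⁻¹ = d_m · diag(ε, 1, (σε)⁻¹)` with `ε = (ϖ^m)⁻¹ α⁻¹` a unit
  set ε : K := (ϖ ^ m)⁻¹ * α⁻¹ with hεdef
  have hϖm0 : ϖ ^ m ≠ 0 := pow_ne_zero m hϖ0
  have hε0 : ε ≠ 0 := mul_ne_zero (inv_ne_zero hϖm0) (inv_ne_zero hj0)
  have hvε : Valued.v ε = 1 := by
    rw [hεdef, map_mul, map_inv₀, map_inv₀, hd.v_pow, hm, ← WithZero.exp_neg, ← WithZero.exp_neg, ← WithZero.exp_add]
    norm_num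
  obtain ⟨d, hdm⟩ := exists_coe_eq_flickerDiag σ hJ hd m
  obtain ⟨tε, htε⟩ := exists_coe_eq_torusDiag σ hJ hσ hε0
  have htεK : tε ∈ unitaryInt σ J := by
    rw [mem_unitaryInt_iff_forall_v_apply_le_one σ hJ hvσ]
    intro i l
    rw [htε]
    fin_cases i <;> fin_cases l <;> simp [map_inv₀, hvσ, hvε]
  have hprod : d * tε * t = 1 := by
    have hσt : σ (ϖ ^ m) = ϖ ^ m := by rw [map_pow, hd.σϖ]
    apply Subtype.ext
    apply Units.ext
    rw [Subgroup.coe_mul, Subgroup.coe_mul, Units.val_mul, Units.val_mul, hdm, htε, ht, Subgroup.coe_one, Units.val_one]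
    ext i l
    fin_cases i <;> fin_cases l <;> simp [Matrix.mul_apply, Fin.sum_univ_three, hεdef, map_mul, map_inv₀, hσt] <;> field_simp
  have htinv : t⁻¹ = d * tε := (inv_eq_of_mul_eq_one_left hprod)
  refine ⟨m, x * k₁' * t, d, tε * k₁'⁻¹, hfix, hdm, (unitaryInt σ J).mul_mem htεK ((unitaryInt σ J).inv_mem ?_), ?_⟩
  · exact hk₁
  · calc x = x * k₁' * t * (t⁻¹ * k₁'⁻¹) := by group
      _ = x * k₁' * t * (d * tε * k₁'⁻¹) := by rw [htinv]
      _ = x * k₁' * t * d * (tε * k₁'⁻¹) := by group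

/-! ## §3 (B′) Disjointness: `H″ d_m K₀ = H″ d_n K₀ ⇒ m = n` (the sup-norm of `g⁻¹ w₀`) -/

/-- Integral matrices do not increase the sup-norm: `|A_{ij}| ≤ 1`, `|u_i| ≤ e` ⇒ `|(A u)_i| ≤ e`. [cite: Omeara1963, §82F] -/
theorem v_mulVec_apply_le_of_forall_le {A : Matrix (Fin 3) (Fin 3) K} (hA : ∀ i j, Valued.v (A i j) ≤ 1) {u : Fin 3 → K} {e : ℤᵐ⁰}
    (hu : ∀ i, Valued.v (u i) ≤ e) (i : Fin 3) : Valued.v ((A *ᵥ u) i) ≤ e := by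
  rw [Matrix.mulVec, dotProduct]
  refine Valuation.map_sum_le _ fun j _ => ?_
  rw [map_mul]
  calc Valued.v (A i j) * Valued.v (u j) ≤ 1 * e := mul_le_mul' (hA i j) (hu j)
    _ = e := one_mul e

/-- … and do not lose it either: if `|A_{ij}| ≤ 1` and some coordinate of `A u` has valuation `≥ e`, then so does some coordinate of `u`. [cite: Omeara1963, §82F] -/
theorem exists_le_v_apply_of_le_v_mulVec_apply {A : Matrix (Fin 3) (Fin 3) K} (hA : ∀ i j, Valued.v (A i j) ≤ 1) {u : Fin 3 → K} {e : ℤᵐ⁰}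
    (he : e ≠ 0) {i : Fin 3} (hi : e ≤ Valued.v ((A *ᵥ u) i)) : ∃ j, e ≤ Valued.v (u j) := by
  by_contra H
  push Not at H
  have hlt : Valued.v ((A *ᵥ u) i) < e := by
    rw [Matrix.mulVec, dotProduct]
    refine Valuation.map_sum_lt _ he fun j _ => ?_
    rw [map_mul]
    calc Valued.v (A i j) * Valued.v (u j) ≤ 1 * Valued.v (u j) := mul_le_mul' (hA i j) le_rfl
      _ < e := by rw [one_mul]; exact H j
  exact (lt_irrefl _) (lt_of_le_of_lt hi hlt)

include hJ in
/-- **A line-stabiliser of the anisotropic `w₀` scales it by a UNIT**: `h w₀ = κ w₀`, `h ∈ U` ⇒ `|κ| = 1` (`B₀ w₀ w₀ = −4ϖ ≠ 0` is preserved).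
[cite: Flicker1998UnitaryFL, Prop. 4 p. 81] -/
theorem v_eq_one_of_mulVec_anisoVec_eq_smul (hd : LocalConjDatum σ ϖ) {h : ↥(unitaryGroupOfForm σ J)} {κ : K}
    (hh : ((h : GL (Fin 3) K) : Matrix (Fin 3) (Fin 3) K) *ᵥ ![1, 0, -(2 * ϖ)] = κ • ![1, 0, -(2 * ϖ)]) : Valued.v κ = 1 := by
  have h20 : (2 : K) ≠ 0 := fun h0 => by have := hd.v2; rw [h0, map_zero] at this; exact zero_ne_one this
  have h4ϖ : -(4 * ϖ) ≠ (0 : K) := by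
    rw [neg_ne_zero, show (4 : K) = 2 * 2 by norm_num]
    exact mul_ne_zero (mul_ne_zero h20 h20) hd.ϖ_ne_zero
  have hB := B₀_mulVec_mulVec_of_mem σ hJ h (![1, 0, -(2 * ϖ)] : Fin 3 → K) ![1, 0, -(2 * ϖ)]
  rw [hh] at hB
  simp only [map_smulₛₗ, LinearMap.smul_apply, smul_eq_mul, RingHom.id_apply, B₀_anisoVec σ hd.σϖ] at hB
  have hκ : σ κ * κ = 1 := by
    apply mul_right_cancel₀ h4ϖ
    linear_combination hB
  have hv := congrArg Valued.v hκ
  rw [map_mul, hd.vσ, map_one] at hv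
  exact Literature.NumberTheory.QuadraticForms.OMeara65.WithZeroMulInt.eq_one_of_mul_self hv

include hJ in
/-- One direction of (B′): a representation `g = h · d_m · k` (`h w₀ = κ w₀`, `k ∈ K₀`) forces every `z` with `g z = w₀` to satisfy `‖z‖ = q^m` — stated as:
if also `g = h′ · d_n · k′`, then `m ≤ n`.  [cite: Flicker1998UnitaryFL, Prop. 4 p. 82 («the union ranges only over `m ≥ 0`», disjointness)] -/
theorem le_of_stabilizer_mul_flickerDiag_mul_unitaryInt_eq (hd : LocalConjDatum σ ϖ) {m n : ℕ}
    {h d k h' d' k' : ↥(unitaryGroupOfForm σ J)} {κ κ' : K}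
    (hh : ((h : GL (Fin 3) K) : Matrix (Fin 3) (Fin 3) K) *ᵥ ![1, 0, -(2 * ϖ)] = κ • ![1, 0, -(2 * ϖ)])
    (hdm : ((d : GL (Fin 3) K) : Matrix (Fin 3) (Fin 3) K) = !![ϖ ^ m, 0, 0; 0, 1, 0; 0, 0, (ϖ ^ m)⁻¹]) (hk : k ∈ unitaryInt σ J)
    (hh' : ((h' : GL (Fin 3) K) : Matrix (Fin 3) (Fin 3) K) *ᵥ ![1, 0, -(2 * ϖ)] = κ' • ![1, 0, -(2 * ϖ)])
    (hdn : ((d' : GL (Fin 3) K) : Matrix (Fin 3) (Fin 3) K) = !![ϖ ^ n, 0, 0; 0, 1, 0; 0, 0, (ϖ ^ n)⁻¹]) (hk' : k' ∈ unitaryInt σ J)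
    (heq : h * d * k = h' * d' * k') : m ≤ n := by
  have hϖ0 : ϖ ≠ 0 := hd.ϖ_ne_zero
  have hvκ := v_eq_one_of_mulVec_anisoVec_eq_smul σ hJ hd hh
  have hvκ' := v_eq_one_of_mulVec_anisoVec_eq_smul σ hJ hd hh'
  have hκ0 : κ ≠ 0 := ne_zero_of_v_eq_one hvκ
  have hκ'0 : κ' ≠ 0 := ne_zero_of_v_eq_one hvκ'
  set w₀ : Fin 3 → K := ![1, 0, -(2 * ϖ)] with hw₀
  -- the vectors `y_p := κ⁻¹ · (ϖ^{-p}, 0, −2ϖ^{p+1})` with `d_p y_p = κ⁻¹ w₀`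
  have hy : ∀ (p : ℕ) (c : K) (D : Matrix (Fin 3) (Fin 3) K), D = !![ϖ ^ p, 0, 0; 0, 1, 0; 0, 0, (ϖ ^ p)⁻¹] →
      D *ᵥ (c⁻¹ • ![(ϖ ^ p)⁻¹, 0, -(2 * ϖ) * ϖ ^ p]) = c⁻¹ • w₀ := by
    intro p c D hD
    have hp0 : ϖ ^ p ≠ 0 := pow_ne_zero p hϖ0
    rw [hD, Matrix.mulVec_smul, hw₀]
    congr 1
    ext i
    fin_cases i
    · simp [Matrix.mulVec, dotProduct, Fin.sum_univ_three, hp0]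
    · simp [Matrix.mulVec, dotProduct, Fin.sum_univ_three]
    · simp [Matrix.mulVec, dotProduct, Fin.sum_univ_three]
      field_simp
  -- `z := k⁻¹ y_m` and `z′ := k′⁻¹ y′_n` both solve `g z = w₀`, hence coincide
  set y : Fin 3 → K := κ⁻¹ • ![(ϖ ^ m)⁻¹, 0, -(2 * ϖ) * ϖ ^ m] with hydef
  set y' : Fin 3 → K := κ'⁻¹ • ![(ϖ ^ n)⁻¹, 0, -(2 * ϖ) * ϖ ^ n] with hy'def
  set z : Fin 3 → K := (((k⁻¹ : ↥(unitaryGroupOfForm σ J)) : GL (Fin 3) K) : Matrix (Fin 3) (Fin 3) K) *ᵥ y with hzdef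
  set z' : Fin 3 → K := (((k'⁻¹ : ↥(unitaryGroupOfForm σ J)) : GL (Fin 3) K) : Matrix (Fin 3) (Fin 3) K) *ᵥ y' with hz'def
  have hmat : ∀ a b : ↥(unitaryGroupOfForm σ J), (((a * b : ↥(unitaryGroupOfForm σ J)) : GL (Fin 3) K) : Matrix (Fin 3) (Fin 3) K) =
      ((a : GL (Fin 3) K) : Matrix (Fin 3) (Fin 3) K) * ((b : GL (Fin 3) K) : Matrix (Fin 3) (Fin 3) K) := fun a b => by
    rw [Subgroup.coe_mul, Units.val_mul]
  have hkk : ((k : GL (Fin 3) K) : Matrix (Fin 3) (Fin 3) K) * (((k⁻¹ : ↥(unitaryGroupOfForm σ J)) : GL (Fin 3) K) : Matrix (Fin 3) (Fin 3) K) = 1 := by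
    rw [← hmat, mul_inv_cancel, Subgroup.coe_one, Units.val_one]
  have hkk' : ((k' : GL (Fin 3) K) : Matrix (Fin 3) (Fin 3) K) * (((k'⁻¹ : ↥(unitaryGroupOfForm σ J)) : GL (Fin 3) K) : Matrix (Fin 3) (Fin 3) K) = 1 := by
    rw [← hmat, mul_inv_cancel, Subgroup.coe_one, Units.val_one]
  have hky : ((k : GL (Fin 3) K) : Matrix (Fin 3) (Fin 3) K) *ᵥ z = y := by rw [hzdef, Matrix.mulVec_mulVec, hkk, Matrix.one_mulVec]
  have hk'y' : ((k' : GL (Fin 3) K) : Matrix (Fin 3) (Fin 3) K) *ᵥ z' = y' := by rw [hz'def, Matrix.mulVec_mulVec, hkk', Matrix.one_mulVec]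
  have hgz : (((h * d * k : ↥(unitaryGroupOfForm σ J)) : GL (Fin 3) K) : Matrix (Fin 3) (Fin 3) K) *ᵥ z = w₀ := by
    rw [hmat, hmat, ← Matrix.mulVec_mulVec, ← Matrix.mulVec_mulVec, hky, hydef, hy m κ _ hdm, Matrix.mulVec_smul, hh, smul_smul,
      inv_mul_cancel₀ hκ0, one_smul]
  have hgz' : (((h' * d' * k' : ↥(unitaryGroupOfForm σ J)) : GL (Fin 3) K) : Matrix (Fin 3) (Fin 3) K) *ᵥ z' = w₀ := by
    rw [hmat, hmat, ← Matrix.mulVec_mulVec, ← Matrix.mulVec_mulVec, hk'y', hy'def, hy n κ' _ hdn, Matrix.mulVec_smul, hh', smul_smul,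
      inv_mul_cancel₀ hκ'0, one_smul]
  have hzz' : z = z' := by
    have h1 : (((h * d * k : ↥(unitaryGroupOfForm σ J)) : GL (Fin 3) K) : Matrix (Fin 3) (Fin 3) K) *ᵥ z =
        (((h * d * k : ↥(unitaryGroupOfForm σ J)) : GL (Fin 3) K) : Matrix (Fin 3) (Fin 3) K) *ᵥ z' := by rw [hgz, heq, hgz']
    have h2 := congrArg (fun u => ((((h * d * k)⁻¹ : ↥(unitaryGroupOfForm σ J)) : GL (Fin 3) K) : Matrix (Fin 3) (Fin 3) K) *ᵥ u) h1
    simp only [Matrix.mulVec_mulVec, ← hmat, inv_mul_cancel, Subgroup.coe_one, Units.val_one, Matrix.one_mulVec] at h2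
    exact h2
  -- valuations: `|y_0| = q^m`, all `|y_i| ≤ q^m`; `k⁻¹, k′ ∈ GL₃(𝒪)`
  have hvy0 : Valued.v (y 0) = WithZero.exp (m : ℤ) := by
    rw [hydef, Pi.smul_apply, smul_eq_mul, map_mul, map_inv₀, hvκ, inv_one, one_mul, Matrix.cons_val_zero, hd.v_pow_inv]
  -- coordinate valuations of `c⁻¹ · (ϖ^{-p}, 0, −2ϖ^{p+1})` for a unit `c`
  have hval : ∀ (p : ℕ) (c : K), Valued.v c = 1 → ∀ i, Valued.v ((c⁻¹ • ![(ϖ ^ p)⁻¹, 0, -(2 * ϖ) * ϖ ^ p] : Fin 3 → K) i) ≤ WithZero.exp (p : ℤ) := by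
    intro p c hc i
    have hi : i = 0 ∨ i = 1 ∨ i = 2 := by fin_cases i <;> simp
    rcases hi with rfl | rfl | rfl
    · rw [Pi.smul_apply, smul_eq_mul, map_mul, map_inv₀, hc, inv_one, one_mul, Matrix.cons_val_zero, hd.v_pow_inv]
    · simp
    · rw [Pi.smul_apply, smul_eq_mul, map_mul, map_inv₀, hc, inv_one, one_mul,
        show (![(ϖ ^ p)⁻¹, 0, -(2 * ϖ) * ϖ ^ p] : Fin 3 → K) 2 = -(2 * ϖ) * ϖ ^ p from rfl,
        map_mul, Valuation.map_neg, map_mul, hd.v2, one_mul, hd.vϖ, hd.v_pow, ← WithZero.exp_add, WithZero.exp_le_exp]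
      omega
  have hvy : ∀ i, Valued.v (y i) ≤ WithZero.exp (m : ℤ) := hval m κ hvκ
  have hvy' : ∀ i, Valued.v (y' i) ≤ WithZero.exp (n : ℤ) := hval n κ' hvκ'
  have hkinv : ∀ i j, Valued.v ((((k⁻¹ : ↥(unitaryGroupOfForm σ J)) : GL (Fin 3) K) : Matrix (Fin 3) (Fin 3) K) i j) ≤ 1 :=
    (mem_unitaryInt_iff.1 ((unitaryInt σ J).inv_mem hk)).1
  have hk'inv : ∀ i j, Valued.v ((((k'⁻¹ : ↥(unitaryGroupOfForm σ J)) : GL (Fin 3) K) : Matrix (Fin 3) (Fin 3) K) i j) ≤ 1 :=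
    (mem_unitaryInt_iff.1 ((unitaryInt σ J).inv_mem hk')).1
  have hkent : ∀ i j, Valued.v (((k : GL (Fin 3) K) : Matrix (Fin 3) (Fin 3) K) i j) ≤ 1 := (mem_unitaryInt_iff.1 hk).1
  -- `q^m = |y_0| = |(k z)_0|` ⇒ some `|z_j| ≥ q^m`; and `z = z′ = k′⁻¹ y′` has all `|z_j| ≤ q^n`
  obtain ⟨j, hj⟩ := exists_le_v_apply_of_le_v_mulVec_apply hkent (e := WithZero.exp (m : ℤ)) WithZero.coe_ne_zero (i := 0) (u := z)
    (le_of_eq (by rw [hky, hvy0]))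
  have hzn : Valued.v (z j) ≤ WithZero.exp (n : ℤ) := by
    rw [hzz', hz'def]
    exact v_mulVec_apply_le_of_forall_le hk'inv hvy' j
  have := hj.trans hzn
  rw [WithZero.exp_le_exp] at this
  exact_mod_cast this

include hJ in
/-- **(B′) FLICKER'S SECOND DECOMPOSITION — disjointness**: `h · d_m · k = h′ · d_n · k′` with `h, h′` in the LINE stabiliser of `w₀` (`h w₀ = κ w₀`, `h′ w₀ = κ′ w₀`) and
`k, k′ ∈ K₀` forces `m = n`: the double cosets `H″ d_m K₀`, `m ≥ 0`, are pairwise disjoint (the invariant is the sup-norm `q^m` of `g⁻¹ w₀`).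
[cite: Flicker1998UnitaryFL, Prop. 4 pp. 81–82] -/
theorem eq_of_stabilizer_mul_flickerDiag_mul_unitaryInt_eq (hd : LocalConjDatum σ ϖ) {m n : ℕ}
    {h d k h' d' k' : ↥(unitaryGroupOfForm σ J)} {κ κ' : K}
    (hh : ((h : GL (Fin 3) K) : Matrix (Fin 3) (Fin 3) K) *ᵥ ![1, 0, -(2 * ϖ)] = κ • ![1, 0, -(2 * ϖ)])
    (hdm : ((d : GL (Fin 3) K) : Matrix (Fin 3) (Fin 3) K) = !![ϖ ^ m, 0, 0; 0, 1, 0; 0, 0, (ϖ ^ m)⁻¹]) (hk : k ∈ unitaryInt σ J)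
    (hh' : ((h' : GL (Fin 3) K) : Matrix (Fin 3) (Fin 3) K) *ᵥ ![1, 0, -(2 * ϖ)] = κ' • ![1, 0, -(2 * ϖ)])
    (hdn : ((d' : GL (Fin 3) K) : Matrix (Fin 3) (Fin 3) K) = !![ϖ ^ n, 0, 0; 0, 1, 0; 0, 0, (ϖ ^ n)⁻¹]) (hk' : k' ∈ unitaryInt σ J)
    (heq : h * d * k = h' * d' * k') : m = n :=
  le_antisymm (le_of_stabilizer_mul_flickerDiag_mul_unitaryInt_eq σ hJ hd hh hdm hk hh' hdn hk' heq)
    (le_of_stabilizer_mul_flickerDiag_mul_unitaryInt_eq σ hJ hd hh' hdn hk' hh hdm hk heq.symm)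

end UnitaryGroup

end Literature.NumberTheory.Automorphic

end
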